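import Mathlib
import Summits.MatrixMultiplication.MatrixMultiplication.Theorems.SnSubsetDichotomyHyperoctahedralThresholdTwinSupplyCSCyclic

/-!
# Cauchy–Schwarz supply, part 3 of 3: the twin supply on ordered pairs of distinct points

Helper for crux `SnSubsetDichotomy.HyperoctahedralThreshold` (stmt-MatrixMultiplication-10883), twins route;
applies `supply` / `supply_cyclic` of `…TwinSupplyCS(Cyclic)` to the diagonal action of the `μ c` on
`{(p, q) : p ≠ q}` (`|α| = n(n-1)`), whose based closed walks are the TWIN PRE-PAIRS `(p, q, v)`:
`p ≠ q`, `p · v = p`, `q · v = q`.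

* `twin_supply`: `(3·2^(k-1))² ≤ n(n-1)·3·2^(k-1) + ∑_{i<k} 2^i · #{(p, q, v) : v reduced, |v| = 2(k-i)}`;
  with `3·2^(k-1) ≥ 2n(n-1)` (`k ≈ 2 log₂ n + 1`) the weighted twin count is `≥ 9·4^(k-1)/2`.
* `twin_supply_cyclic` / `stub_twinSupplyCS` (registered form): the same with cyclically reduced `z`, weight
  `(s+1)·2^s` and main term `n(n-1)·(3·2^(k-1) + k·2^k)`; the summand is `∑_{|z| = 2(k-s)} N_z²` with the
  diagonal included (`N_z = |Fix z|`), so the genuine twins `∑_z N_z (N_z - 1)` are this count minus the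
  closed-walk count `T_{2(k-s)}` of `closedWalk_supply_cyclic`.
[crux research log `Cruxes/HyperoctahedralThreshold/NOTES.md` §2 (S-twin), §11 SUPPLY, §12.3]
-/

-- the tree's namespace `Summit.MatrixMultiplication.MatrixMultiplication.…` repeats a component by design
set_option linter.dupNamespace false

namespace Summit.MatrixMultiplication.MatrixMultiplication.Theorems.HyperoctahedralThreshold

namespace TwinSupplyCS

open Finset

/-- The diagonal action on ordered pairs of distinct points. -/
def pairPerm {n : ℕ} (μ : Fin 3 → Equiv.Perm (Fin n)) (c : Fin 3) :
    Equiv.Perm {pq : Fin n × Fin n // pq.1 ≠ pq.2} :=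
  (Equiv.prodCongr (μ c) (μ c)).subtypeEquiv fun _ => (μ c).injective.ne_iff.symm

/-- The diagonal action of a word acts coordinatewise. -/
theorem val_act_pairPerm {n : ℕ} (μ : Fin 3 → Equiv.Perm (Fin n)) (g : List (Fin 3))
    (pq : {pq : Fin n × Fin n // pq.1 ≠ pq.2}) :
    (act (pairPerm μ) pq g).1 = (g.foldl (fun v c => μ c v) pq.1.1, g.foldl (fun v c => μ c v) pq.1.2) := by
  induction g generalizing pq with
  | nil => simp [act]
  | cons c g ih =>
    have : act (pairPerm μ) pq (c :: g) = act (pairPerm μ) (pairPerm μ c pq) g := by simp [act]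
    rw [this, ih]
    simp [pairPerm]

/-- **Twin supply on `Fin n`** (Cauchy–Schwarz on the pair action).  For three involutions of `Fin n`
(`n ≥ 2`) and `k ≥ 1`, the based reduced TWIN PRE-PAIRS `(p, q, v)` — `p ≠ q`, `v` reduced of length
`2(k-i)`, `p·v = p` and `q·v = q` — weighted by `2^i` satisfy
`(3·2^(k-1))² ≤ n(n-1) · 3·2^(k-1) + ∑_{i<k} 2^i · #{(p, q, v)}`.  In particular with `3·2^(k-1) ≥ 2n(n-1)`
the weighted twin count is at least `|RW k|²/2 = 9·4^(k-1)/2`. -/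
theorem twin_supply (n k : ℕ) (hn : 2 ≤ n) (hk : 1 ≤ k) (μ : Fin 3 → Equiv.Perm (Fin n))
    (hμ : ∀ c, μ c * μ c = 1) :
    (3 * 2 ^ (k - 1)) ^ 2 ≤ n * (n - 1) * (3 * 2 ^ (k - 1)) + ∑ i ∈ range k, 2 ^ i *
      (((univ : Finset (Fin n)) ×ˢ (univ : Finset (Fin n)) ×ˢ RW (2 * (k - i))).filter
        fun t => t.1 ≠ t.2.1 ∧ t.2.2.foldl (fun v c => μ c v) t.1 = t.1 ∧
          t.2.2.foldl (fun v c => μ c v) t.2.1 = t.2.1).card := by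
  haveI : Nonempty {pq : Fin n × Fin n // pq.1 ≠ pq.2} :=
    ⟨⟨(⟨0, by omega⟩, ⟨1, by omega⟩), by simp [Fin.ext_iff]⟩⟩
  have hinv : ∀ c, Function.Involutive (pairPerm μ c) := by
    rintro c ⟨⟨p, q⟩, hpq⟩
    apply Subtype.ext
    simp [pairPerm, involutive_of_mul_self μ hμ c p, involutive_of_mul_self μ hμ c q]
  have hcard : Fintype.card {pq : Fin n × Fin n // pq.1 ≠ pq.2} = n * (n - 1) := by
    rw [Fintype.card_subtype]
    have : ((univ : Finset (Fin n × Fin n)).filter fun pq => pq.1 ≠ pq.2) =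
        (univ : Finset (Fin n)).offDiag := by
      ext pq; simp [mem_offDiag]
    rw [this, offDiag_card, card_univ, Fintype.card_fin, Nat.mul_sub_one]
  have h := supply (pairPerm μ) hinv k
  rw [card_RW hk, hcard] at h
  refine h.trans (Nat.add_le_add_left ?_ _)
  refine sum_le_sum fun i _ => Nat.mul_le_mul_left _ ?_
  rw [sum_card_closedAt]
  -- inject the pair-based closed walks into the triples `(p, q, v)`
  refine card_le_card_of_injOn (fun xv => (xv.1.1.1, xv.1.1.2, xv.2)) ?_ ?_
  · rintro ⟨pq, v⟩ h
    rw [mem_coe, mem_filter, mem_product] at h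
    obtain ⟨⟨-, hv⟩, hfix⟩ := h
    have hval := congrArg Subtype.val hfix
    rw [val_act_pairPerm] at hval
    simp only [coe_filter, mem_product, mem_univ, true_and, Set.mem_setOf_eq]
    exact ⟨hv, pq.2, (Prod.ext_iff.mp hval).1, (Prod.ext_iff.mp hval).2⟩
  · rintro ⟨pq, v⟩ - ⟨pq', v'⟩ - h
    simp only [Prod.mk.injEq] at h
    obtain ⟨h1, h2, rfl⟩ := h
    rw [Prod.mk.injEq]
    exact ⟨Subtype.ext (Prod.ext h1 h2), rfl⟩

/-- **Twin supply on `Fin n`, cyclically reduced form** (the shape used by the union-bound route: the summand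
counts `∑_{|z| = 2(k-s), z cyclically reduced} N_z (N_z - 1) + N_z`-type quantities, `N_z = |Fix z|`, through the
based twin pre-pairs `(p, q, z)`, `p ≠ q ∈ Fix z`).  For `n ≥ 2`, `k ≥ 1`:
`(3·2^(k-1))² ≤ n(n-1)·(3·2^(k-1) + k·2^k) + ∑_{s<k} (s+1)·2^s · #{(p, q, z) : p ≠ q, z cyclically reduced of
length 2(k-s), p·z = p, q·z = q}`. -/
theorem twin_supply_cyclic (n k : ℕ) (hn : 2 ≤ n) (hk : 1 ≤ k) (μ : Fin 3 → Equiv.Perm (Fin n))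
    (hμ : ∀ c, μ c * μ c = 1) :
    (3 * 2 ^ (k - 1)) ^ 2 ≤ n * (n - 1) * (3 * 2 ^ (k - 1) + k * 2 ^ k) +
      ∑ s ∈ range k, (s + 1) * 2 ^ s *
        (((univ : Finset (Fin n)) ×ˢ (univ : Finset (Fin n)) ×ˢ RW (2 * (k - s))).filter
          fun t => t.1 ≠ t.2.1 ∧ List.IsChain (· ≠ ·) (t.2.2 ++ t.2.2) ∧
            t.2.2.foldl (fun v c => μ c v) t.1 = t.1 ∧ t.2.2.foldl (fun v c => μ c v) t.2.1 = t.2.1).card := by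
  haveI : Nonempty {pq : Fin n × Fin n // pq.1 ≠ pq.2} :=
    ⟨⟨(⟨0, by omega⟩, ⟨1, by omega⟩), by simp [Fin.ext_iff]⟩⟩
  have hinv : ∀ c, Function.Involutive (pairPerm μ c) := by
    rintro c ⟨⟨p, q⟩, hpq⟩
    apply Subtype.ext
    simp [pairPerm, involutive_of_mul_self μ hμ c p, involutive_of_mul_self μ hμ c q]
  have hcard : Fintype.card {pq : Fin n × Fin n // pq.1 ≠ pq.2} = n * (n - 1) := by
    rw [Fintype.card_subtype]
    have : ((univ : Finset (Fin n × Fin n)).filter fun pq => pq.1 ≠ pq.2) =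
        (univ : Finset (Fin n)).offDiag := by
      ext pq; simp [mem_offDiag]
    rw [this, offDiag_card, card_univ, Fintype.card_fin, Nat.mul_sub_one]
  have h := supply_cyclic (pairPerm μ) hinv k
  rw [card_RW hk, hcard] at h
  refine h.trans (Nat.add_le_add_left ?_ _)
  refine sum_le_sum fun s _ => Nat.mul_le_mul_left _ ?_
  -- inject the pair-based cyclically reduced closed walks into the triples `(p, q, z)`
  refine card_le_card_of_injOn (fun xv => (xv.1.1.1, xv.1.1.2, xv.2)) ?_ ?_
  · rintro ⟨pq, v⟩ h
    rw [mem_coe, cycPairs, mem_filter, mem_closedPairs] at h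
    obtain ⟨⟨⟨hvl, hvc⟩, hfix⟩, hcyc⟩ := h
    have hval := congrArg Subtype.val hfix
    rw [val_act_pairPerm] at hval
    simp only [coe_filter, mem_product, mem_univ, true_and, Set.mem_setOf_eq, mem_RW]
    exact ⟨⟨hvl, hvc⟩, pq.2, hcyc, (Prod.ext_iff.mp hval).1, (Prod.ext_iff.mp hval).2⟩
  · rintro ⟨pq, v⟩ - ⟨pq', v'⟩ - h
    simp only [Prod.mk.injEq] at h
    obtain ⟨h1, h2, rfl⟩ := h
    rw [Prod.mk.injEq]
    exact ⟨Subtype.ext (Prod.ext h1 h2), rfl⟩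

/-- **`stub_twinSupplyCS`** (registered sub-goal of stmt-MatrixMultiplication-10883): the twin supply in
cyclically reduced form — based twin pre-pairs `(p, q, z)`, `p ≠ q ∈ Fix z`, `z` cyclically reduced of length
`2(k-s)`, weighted by `(s+1)·2^s`, against `(3·2^(k-1))² - (n² - n)·(3·2^(k-1) + k·2^k)`. -/
theorem stub_twinSupplyCS : ∀ (n k : ℕ) (μ : Fin 3 → Equiv.Perm (Fin n)), (∀ c, μ c * μ c = 1) → 2 ≤ n → 1 ≤ k → (3 * 2 ^ (k - 1)) ^ 2 ≤ (n * n - n) * (3 * 2 ^ (k - 1) + k * 2 ^ k) + ∑ s ∈ Finset.range k, (s + 1) * 2 ^ s * (((Finset.univ : Finset (Fin n)) ×ˢ (Finset.univ : Finset (Fin n)) ×ˢ (((Finset.univ : Finset (List.Vector (Fin 3) (2 * (k - s)))).image (fun v => v.toList)).filter (fun z => List.IsChain (· ≠ ·) (z ++ z)))).filter (fun t => t.1 ≠ t.2.1 ∧ t.2.2.foldl (fun v c => μ c v) t.1 = t.1 ∧ t.2.2.foldl (fun v c => μ c v) t.2.1 = t.2.1)).card := by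
  intro n k μ hμ hn hk
  have h := twin_supply_cyclic n k hn hk μ hμ
  rw [show n * n - n = n * (n - 1) by rw [Nat.mul_sub, mul_one]]
  refine h.trans (Nat.add_le_add_left (le_of_eq ?_) _)
  refine sum_congr rfl fun s _ => ?_
  congr 1
  rw [← filter_RW_eq_vector]
  apply congrArg Finset.card
  ext ⟨p, q, z⟩
  simp only [mem_filter, mem_product, mem_univ, true_and, mem_RW]
  constructor
  · rintro ⟨⟨hl, hc⟩, hpq, hcyc, hp, hq⟩
    exact ⟨⟨⟨hl, hc⟩, hcyc⟩, hpq, hp, hq⟩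
  · rintro ⟨⟨⟨hl, hc⟩, hcyc⟩, hpq, hp, hq⟩
    exact ⟨⟨hl, hc⟩, hpq, hcyc, hp, hq⟩
end TwinSupplyCS

end Summit.MatrixMultiplication.MatrixMultiplication.Theorems.HyperoctahedralThreshold
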